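import Literature.Computability.Complexity.LinearityTest
import HarnessLib

/-!
# The tensor test and the random-equation test of the Hadamard-based PCP (Arora–Barak §11.5.2)

The two applications of the random subsum principle in the soundness analysis of the
`(poly(n), 1)`-verifier for `QUADEQ` (Arora–Barak 2009, Thm. 11.19, proof in §11.5.2, Steps 2 and 3),
as exact counting statements over `GF(2)` (vectors `Fin n → Bool`, inner product `BLR.dot` of
`LinearityTest.lean`):

* **Step 2 (tensor test).**  For matrices `W, U ∈ GF(2)^{n×n}` and row/column vectors `r, r'`,
  `r W r' = (rW) ⊙ r'` (`bilin`).  If `f = (u ⊙ ·)` and `g = (w ⊙ ·)` are linear with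
  `w ≠ u ⊗ u`, i.e. `W ≠ U = (uᵢ uⱼ)`, then `f(r) f(r') ≠ g(r ⊗ r')` for at least a quarter of the
  pairs `(r, r')` (`four_mul_card_tensorTest_reject_ge`): "if `W ≠ U` then at least `1/2` of all `r`
  satisfy `rW ≠ rU` … for each such `r` … at least `1/2` the `r'` satisfy `rWr' ≠ rUr'`".
  The identity `f(r) f(r') = r U r'` is `bilin_tensorSelf`.
* **Step 3 (random subset of equations).**  If an assignment violates at least one of `m` equations
  then the `GF(2)`-sum of a uniformly random subset of the equations is violated for exactly half of
  the subsets (`two_mul_card_subsetSum_violated`): "the random subsum principle implies that if `u`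
  does not satisfy even one equation … then with probability at least `1/2` it will not satisfy this
  new equation".

## References

* S. Arora, B. Barak, *Computational Complexity: A Modern Approach*, CUP 2009, §11.5.2 (proof of
  Thm. 11.19, Steps 2–3), §11.5.1 (random subsum principle).
-/

noncomputable section

namespace Literature.Computability.Complexity

open Finset

namespace BLR

variable {n m : ℕ}

/-! ### Small algebra of `dot` -/

/-- The inner product is symmetric. [folklore] -/
theorem dot_comm (u x : Fin n → Bool) : dot u x = dot x u := by
  unfold dot
  congr 3
  ext i
  simp only [mem_filter, mem_univ, true_and]
  exact and_comm

/-- The zero vector is orthogonal to everything: `0 ⊙ x = 0`. [folklore] -/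
theorem dot_zero_left (x : Fin n → Bool) : dot (fun _ => false) x = false := by
  unfold dot
  rw [filter_false_of_mem fun i _ => by simp, card_empty]
  decide

/-- Scaling a vector by a bit: `(c u) ⊙ x = c (u ⊙ x)`. [folklore] -/
theorem dot_and_const (u x : Fin n → Bool) (c : Bool) : dot (fun i => u i && c) x = (dot u x && c) := by
  cases c
  · simp only [Bool.and_false]
    exact dot_zero_left x
  · simp only [Bool.and_true]

/-! ### Step 2: the tensor test -/

/-- The row vector `rW ∈ GF(2)ⁿ`: `(rW)ⱼ = ∑ᵢ rᵢ Wᵢⱼ`. [cite: AroraBarakCC2009, §11.5.2 (Step 2)] -/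
def rowMul (W : Fin n → Fin n → Bool) (r : Fin n → Bool) : Fin n → Bool := fun j => dot (fun i => W i j) r

/-- The bilinear form `r W r' = (rW) ⊙ r' = ∑ᵢⱼ Wᵢⱼ rᵢ r'ⱼ` over `GF(2)` — the value `g(r ⊗ r')` of the
linear function `g = (w ⊙ ·)` with matrix `W`. [cite: AroraBarakCC2009, §11.5.2 (Step 2, "g(r ⊗ r') = rWr'")] -/
def bilin (W : Fin n → Fin n → Bool) (r r' : Fin n → Bool) : Bool := dot (rowMul W r) r'

/-- The tensor square `U = u ⊗ u`, `Uᵢⱼ = uᵢ uⱼ`. [cite: AroraBarakCC2009, §11.5.2 (footnote 4)] -/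
def tensorSelf (u : Fin n → Bool) : Fin n → Fin n → Bool := fun i j => u i && u j

/-- `r (u ⊗ u) = (u ⊙ r) u`. [folklore] -/
theorem rowMul_tensorSelf (u r : Fin n → Bool) : rowMul (tensorSelf u) r = fun j => u j && dot u r := by
  funext j
  rw [rowMul, show (fun i => tensorSelf u i j) = fun i => u i && u j from rfl, dot_and_const, Bool.and_comm]

/-- **`f(r) f(r') = r U r'`** for `f = (u ⊙ ·)` and `U = u ⊗ u`:
`(u ⊙ r)(u ⊙ r') = ∑ᵢⱼ uᵢ uⱼ rᵢ r'ⱼ`. [cite: AroraBarakCC2009, §11.5.2 (Step 2, "f(r)f(r') = rUr'")] -/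
theorem bilin_tensorSelf (u r r' : Fin n → Bool) : bilin (tensorSelf u) r r' = (dot u r && dot u r') := by
  rw [bilin, rowMul_tensorSelf, dot_and_const, Bool.and_comm]

/-- Distinct matrices have a distinct column. [folklore] -/
theorem exists_col_ne {W U : Fin n → Fin n → Bool} (h : W ≠ U) : ∃ j, (fun i => W i j) ≠ fun i => U i j := by
  by_contra hall
  push Not at hall
  exact h (funext fun i => funext fun j => congrFun (hall j) i)

/-- **First subsum**: if `W ≠ U` then `rW ≠ rU` for at least half of the row vectors `r`.
[cite: AroraBarakCC2009, §11.5.2 (Step 2)] -/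
theorem two_mul_card_rowMul_ne_ge {W U : Fin n → Fin n → Bool} (h : W ≠ U) :
    2 ^ n ≤ 2 * (univ.filter fun r => rowMul W r ≠ rowMul U r).card := by
  obtain ⟨j, hj⟩ := exists_col_ne h
  rw [← two_mul_card_dot_ne hj]
  refine Nat.mul_le_mul_left 2 (card_le_card fun r hr => ?_)
  simp only [mem_filter, mem_univ, true_and] at hr ⊢
  exact fun hrow => hr (congrFun hrow j)

/-- **The tensor test rejects a quarter of the time** (Arora–Barak, §11.5.2, Step 2): if `W ≠ U` then
`r W r' ≠ r U r'` for at least `4ⁿ/4` of the pairs `(r, r') ∈ GF(2)ⁿ × GF(2)ⁿ`.  With `U = u ⊗ u`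
(`bilin_tensorSelf`) this is: if the linear `g = (w ⊙ ·)` is not the encoding of `u ⊗ u` then
`f(r) f(r') ≠ g(r ⊗ r')` with probability at least `1/4`.
[cite: AroraBarakCC2009, §11.5.2 (Step 2, "the trial rejects for at least 1/4 of all pairs")] -/
theorem four_mul_card_tensorTest_reject_ge {W U : Fin n → Fin n → Bool} (h : W ≠ U) :
    4 ^ n ≤ 4 * (univ.filter fun p : (Fin n → Bool) × (Fin n → Bool) => bilin W p.1 p.2 ≠ bilin U p.1 p.2).card := by
  classical
  set good : Finset (Fin n → Bool) := univ.filter fun r => rowMul W r ≠ rowMul U r with hgood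
  -- count the rejecting pairs fibrewise over `r`
  have hfib : (univ.filter fun p : (Fin n → Bool) × (Fin n → Bool) => bilin W p.1 p.2 ≠ bilin U p.1 p.2).card =
      ∑ r, (univ.filter fun r' => bilin W r r' ≠ bilin U r r').card := by
    rw [card_filter, Fintype.sum_prod_type]
    refine sum_congr rfl fun r _ => ?_
    rw [card_filter]
  -- over a good `r`, exactly half of the `r'` reject (second subsum)
  have hhalf : ∀ r ∈ good, 2 * (univ.filter fun r' => bilin W r r' ≠ bilin U r r').card = 2 ^ n := fun r hr => by
    simp only [hgood, mem_filter, mem_univ, true_and] at hr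
    exact two_mul_card_dot_ne hr
  have hsum : good.card * 2 ^ n ≤ 2 * ∑ r, (univ.filter fun r' => bilin W r r' ≠ bilin U r r').card := by
    calc good.card * 2 ^ n = ∑ r ∈ good, 2 * (univ.filter fun r' => bilin W r r' ≠ bilin U r r').card := by
          rw [sum_congr rfl hhalf, sum_const, smul_eq_mul]
      _ = 2 * ∑ r ∈ good, (univ.filter fun r' => bilin W r r' ≠ bilin U r r').card := by rw [mul_sum]
      _ ≤ 2 * ∑ r, (univ.filter fun r' => bilin W r r' ≠ bilin U r r').card :=
          Nat.mul_le_mul_left 2 (sum_le_sum_of_subset_of_nonneg (subset_univ _) fun _ _ _ => Nat.zero_le _)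
  have hgoodcard := two_mul_card_rowMul_ne_ge h
  rw [← hgood] at hgoodcard
  rw [hfib]
  calc 4 ^ n = 2 ^ n * 2 ^ n := by rw [← mul_pow]; norm_num
    _ ≤ (2 * good.card) * 2 ^ n := Nat.mul_le_mul_right _ hgoodcard
    _ = 2 * (good.card * 2 ^ n) := by ring
    _ ≤ 2 * (2 * ∑ r, (univ.filter fun r' => bilin W r r' ≠ bilin U r r').card) := Nat.mul_le_mul_left 2 hsum
    _ = 4 * ∑ r, (univ.filter fun r' => bilin W r r' ≠ bilin U r r').card := by ring

/-! ### Step 3: a random subset of the equations -/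

/-- The `GF(2)`-sum of the bits `e_k` over the subset `s ⊆ [m]` is `s ⊙ e`; if `e ≠ 0` (some equation is
violated, `e_k = [lhs_k(u) ≠ b_k]`) then the summed equation is violated, `s ⊙ e = 1`, for exactly half
of the subsets `s` (random subsum principle against the zero vector).
[cite: AroraBarakCC2009, §11.5.2 (Step 3, random subset of the equations)] -/
theorem two_mul_card_subsetSum_violated {e : Fin m → Bool} (he : e ≠ fun _ => false) :
    2 * (univ.filter fun s : Fin m → Bool => dot s e = true).card = 2 ^ m := by
  rw [← two_mul_card_dot_ne he]
  congr 2
  ext s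
  simp only [mem_filter, mem_univ, true_and, dot_zero_left, dot_comm e s]
  cases dot s e <;> simp

/-- The same for a system of quadratic equations `u Aₖ u = bₖ`, `k < m`: if `u` violates some equation
then for exactly half of the subsets `s`, `∑_{k ∈ s} u Aₖ u ≠ ∑_{k ∈ s} bₖ` over `GF(2)` — written with
the violation bits `eₖ = (u Aₖ u) + bₖ`, whose subset sums are `s ⊙ e`.
[cite: AroraBarakCC2009, §11.5.2 (Step 3)] -/
theorem two_mul_card_subsetSum_quadEq {A : Fin m → Fin n → Fin n → Bool} {b : Fin m → Bool} {u : Fin n → Bool}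
    (hviol : ∃ k, bilin (A k) u u ≠ b k) :
    2 * (univ.filter fun s : Fin m → Bool => dot s (fun k => xor (bilin (A k) u u) (b k)) = true).card = 2 ^ m := by
  refine two_mul_card_subsetSum_violated fun he => ?_
  obtain ⟨k, hk⟩ := hviol
  have := congrFun he k
  apply hk
  revert this
  cases bilin (A k) u u <;> cases b k <;> simp

end BLR

end Literature.Computability.Complexity

end
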